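import Literature.NumberTheory.EllipticCurves.IwasawaCoinvariantsRankProofs
import Literature.NumberTheory.EllipticCurves.TwoVariableSelmerTower
import HarnessLib

/-!
# Route C `PrintCf2RubinValueTwo`, crux `RestrictedMainConjWithValueAtTwo` (stmt-BirchSwinnertonDyer-23722), brick (RES)(b2), input (G) continued:
# the SMALL OPEN NORMAL SUBGROUP attached to a continuous cocycle on ANY closed subgroup `Q ≤ Γ_K` — the topological half of the supply of
# the finite-index subgroup `U` of `oneCocycleClass_eq_zero_of_index_coprime` (p686012) for `Q = ker κ₂ ⊓ decomp w`

Cell `bsd-print-cf2`, width seat `bsd-line-cf2c-w8` g0 (prover-bsd-line-cf2c-w8-g0-0); `--supports stmt-BirchSwinnertonDyer-23722`. HONEST FRAMING: generic;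
nothing here closes the crux or the registered stub; BSD is not proved by any of this; no summit statement is proved by this seat. No definition, no named
fact, no `sorry`.
* `exists_good_subgroup_of_isClosed` — for a closed subgroup `Q` of `Γ_K` (compact), a continuous cocycle `c` on `Q` with values in a discrete module
  with continuous orbits, and `m ∈ M`: an open normal subgroup `V` of `Γ_K` fixing `m` and every value of `c` and with `V ∩ Q` inside the zero set of `c`
  (the tree's `exists_good_subgroup` / this seat's `exists_good_subgroup_pairKer` for an arbitrary closed `Q`). With p686012: if `((V ⊓ Q) · N)` has
  index prime to `p` in `Q` for the relevant normal `N` (arithmetic of the place), every `p`-primary-valued class on `Q` vanishing on `N` dies.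
presearch: Serre *Galois Cohomology* I §1.1, §2.2 (held) — port, no new fact.

References: [SerreGaloisCohomology1997] I §1.1, §2.2, §5.1.
-/

noncomputable section

open scoped Classical

set_option autoImplicit false

open Literature.NumberTheory.EllipticCurves Literature.NumberTheory.GaloisRepresentations

universe u

namespace Literature.NumberTheory.EllipticCurves.ZpExtension

section Good

variable {K : Type u} [Field K]
  {M : Type u} [AddCommGroup M] [DistribMulAction (Field.absoluteGaloisGroup K) M] [TopologicalSpace M] [DiscreteTopology M]

/-- **A small open normal subgroup for a cocycle on a closed subgroup `Q ≤ Γ_K`**: `V ◁ Γ_K` open, fixing `m` and the (finitely many) values of `c`,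
with `V ∩ Q ⊆ {c = 0}` (`ProfiniteGrp.exist_openNormalSubgroup_sub_open_nhds_of_one`). [cite: SerreGaloisCohomology1997, I §1.1 and §2.2] -/
theorem exists_good_subgroup_of_isClosed (Q : Subgroup (Field.absoluteGaloisGroup K))
    (hQ : IsClosed (Q : Set (Field.absoluteGaloisGroup K))) (hcont : ∀ m : M, Continuous fun g : Field.absoluteGaloisGroup K ↦ g • m)
    (c : contOneCocycles (discreteTopRep Q M)) (m : M) :
    ∃ V : Subgroup (Field.absoluteGaloisGroup K), V.Normal ∧ IsOpen (V : Set (Field.absoluteGaloisGroup K)) ∧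
      (∀ v ∈ V, v • m = m) ∧ (∀ v ∈ V, ∀ τ : Q, v • c.1 τ = c.1 τ) ∧
      (∀ v ∈ V, ∀ hv : v ∈ Q, c.1 ⟨v, hv⟩ = 0) := by
  have hO₁ : IsOpen {g : Field.absoluteGaloisGroup K | g • m = m} := (isOpen_discrete ({m} : Set M)).preimage (hcont m)
  haveI : CompactSpace (Field.absoluteGaloisGroup K) := absoluteGaloisGroup_compactSpace K
  haveI : CompactSpace Q := isCompact_iff_compactSpace.mp hQ.isCompact
  have hfin : (Set.range c.1).Finite := (isCompact_range c.1.continuous).finite_of_discrete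
  have hO₂ : IsOpen (⋂ v ∈ Set.range c.1, {g : Field.absoluteGaloisGroup K | g • v = v}) :=
    hfin.isOpen_biInter fun v _ ↦ (isOpen_discrete ({v} : Set M)).preimage (hcont v)
  obtain ⟨t, ht, htZ⟩ := isOpen_induced_iff.mp (ResKernel.isOpen_zeroSubgroup c)
  have hO : IsOpen ({g : Field.absoluteGaloisGroup K | g • m = m} ∩
      (⋂ v ∈ Set.range c.1, {g : Field.absoluteGaloisGroup K | g • v = v}) ∩ t) := (hO₁.inter hO₂).inter ht
  have h1 : (1 : Field.absoluteGaloisGroup K) ∈ {g : Field.absoluteGaloisGroup K | g • m = m} ∩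
      (⋂ v ∈ Set.range c.1, {g : Field.absoluteGaloisGroup K | g • v = v}) ∩ t := by
    refine ⟨⟨one_smul _ _, ?_⟩, ?_⟩
    · simp only [Set.mem_iInter, Set.mem_setOf_eq, one_smul, implies_true]
    · have h1Z : (1 : Q) ∈ (ResKernel.zeroSubgroup c : Set (Q)) := one_mem _
      rw [← htZ] at h1Z
      exact h1Z
  obtain ⟨V, hV⟩ := ProfiniteGrp.exist_openNormalSubgroup_sub_open_nhds_of_one hO h1
  refine ⟨V.toOpenSubgroup.toSubgroup, inferInstance, V.toOpenSubgroup.isOpen, ?_, ?_, ?_⟩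
  · intro v hv
    exact (hV hv).1.1
  · intro v hv τ
    have h := (hV hv).1.2
    simp only [Set.mem_iInter, Set.mem_setOf_eq] at h
    exact h (c.1 τ) ⟨τ, rfl⟩
  · intro v hv hvH
    have h : v ∈ t := (hV hv).2
    have h' : (⟨v, hvH⟩ : Q) ∈ (ResKernel.zeroSubgroup c : Set (Q)) := by
      rw [← htZ]
      exact h
    exact (ResKernel.mem_zeroSubgroup_iff c _).mp h'

end Good

end Literature.NumberTheory.EllipticCurves.ZpExtension
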